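import Summits.PneNP.PneNP.Theses.ExpanderLinearGenerators
import Summits.PneNP.PneNP.Theorems.ExpanderLinearGeneratorsConjAxiomDepthFloor
import Summits.PneNP.PneNP.Theorems.ExpanderLinearGeneratorsLinearGeneratorDepthFregeHardDepthFloor
import Summits.PneNP.PneNP.Theorems.ExpanderLinearGeneratorsLinearGeneratorDepthFregeHardLocalityEight
import Literature.Computability.MetaComplexity.FregeMod
import HarnessLib

/-!
# The depth and locality floors of `LinearGeneratorModPFregeHard` (route ExpanderLinearGenerators,
rung 4 = the `AC⁰[p]`-Frege rung)

Helper file for item `stmt-PneNP-11444`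
(`Summit.PneNP.PneNP.Theses.ExpanderLinearGenerators.LinearGeneratorModPFregeHard`, the
`F_d(MOD_p)` lower bound for expanding linear systems over `𝔽₂`, an instance of Krajíček's open
Problem 15.6.1). The item quantifies over every locality `ℓ ≥ 1`, every depth `d` and every
`0 < δ < 1`; as for the sibling rung `LinearGeneratorDepthFregeHard` (files
`…DepthFregeHardDepthFloor.lean`, `…DepthFregeHardLocalityEight.lean`) two corners hold for reasons
unrelated to lower bounds, and this file kernel-checks them for the system WITH `MOD_p` gates:

* depths `d ≤ 6` (sharpening the `d ≤ 4` of `…ModPFregeHardLowDepth.lean`): every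
  `textbookFrege(MOD_a)` proof of `¬(P ∧ Q)` with `P` a `MOD`-free formula contains the line
  `¬(P ∧ Q) ∨ ¬(¬P ∨ ¬Q)` (`conjAx_mem_of_isModProofOf`: a valuation of the extended language that
  counts `MOD` gates honestly, declares the one formula `P ∧ Q` true and is standard elsewhere
  validates every `MOD_a` axiom — their conjunctions have a `MOD` gate or a negated `MOD` gate on
  the left, so they are not the perturbed pair — and every rule instance except that line); for
  the XOR-CNF of an expanding unsolvable system that line has alternation depth `≥ 7`
  (`seven_le_of_isModDepthProofOf_neg_ofCNF`, `not_isModDepthProofOf_of_le_six`);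
* localities `ℓ ≤ 8`: in the item's regime `r = n^{1-δ}` every `ℓ`-sparse
  `(n^{1-δ}, 3/4·ℓ)`-boundary-expanding system with `ℓ ≤ 8` and `n` large is solvable
  (`systemSat_of_isBoundaryExpander_of_le_eight` of the sibling file), so the unsolvability
  hypothesis is contradictory (`linearGeneratorModPFregeHard_locality_le_eight`).

* `linearGeneratorModPFregeHard_iff_nine_le_and_seven_le` — the item is equivalent to its
  restriction to `ℓ ≥ 9` and `d ≥ 7`; together with `…ModPFregeHardCalibration.lean` (depth-`30`
  refutations always exist) and `…Mod2Easy.lean` (`p = 2` is easy) this locates all of the item's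
  content: odd `p`, `ℓ ≥ 9`, `7 ≤ d`.

References: S. Buss, R. Impagliazzo, J. Krajíček, P. Pudlák, A. A. Razborov, J. Sgall,
Comput. Complexity 6 (1996/97), Def. 1.1 [BussImpagliazzoKrajicekPudlakRazborovSgall1997];
J. Krajíček, *Proof Complexity* (CUP 2019), §15.6 and Problem 15.6.1 [KrajicekProofComplexity2019].
-/

namespace Summit.PneNP.PneNP.Theorems

set_option linter.dupNamespace false -- `Summit.PneNP.PneNP.…`: summit = sub-problem (D-0017)

open Literature.Computability.Complexity
open Literature.Computability.MetaComplexity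
open Literature.Computability.MetaComplexity.PropFormMod

/-! ### Part 1. Every `textbookFrege(MOD_a)` proof of `¬(P ∧ Q)`, `P` `MOD`-free, contains the
`∧`-axiom at `(P, Q)` -/

section ConjAxiom

variable {a : ℕ}

open scoped Classical

/-- **A valuation of the extended language perturbed at `(P, Q)` exists**: Boolean-valued,
standard on constants, `¬`, `∨`, counting `MOD_{a,i}` gates honestly (true iff the number of true
arguments is `≡ i (mod a)`), and standard on `∧` except that the single formula `conj P Q` is
declared `true` (structural recursion; variables are sent to `false`). [folklore] -/
theorem exists_conjPerturbedModVal (P Q : PropFormMod a ℕ) :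
    ∃ v : PropFormMod a ℕ → Bool, (∀ b, v (const b) = b) ∧ (∀ φ, v (neg φ) = !v φ) ∧
      (∀ φ ψ, v (disj φ ψ) = (v φ || v ψ)) ∧
      (∀ φ ψ, v (conj φ ψ) = (decide (φ = P ∧ ψ = Q) || (v φ && v ψ))) ∧
      ∀ (k : ℕ) (i : ZMod a) (args : Fin k → PropFormMod a ℕ),
        v (modc i args) = decide (((∑ j, (v (args j)).toNat : ℕ) : ZMod a) = i) :=
  ⟨@PropFormMod.rec a ℕ (fun _ => Bool) (fun _ => false) (fun b => b) (fun _ r => !r)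
      (fun φ ψ r s => decide (φ = P ∧ ψ = Q) || (r && s)) (fun _ _ r s => r || s)
      (fun i _args ih => decide (((∑ j, (ih j).toNat : ℕ) : ZMod a) = i)),
    fun _ => rfl, fun _ => rfl, fun _ _ => rfl, fun _ _ => rfl, fun _ _ _ => rfl⟩

/-- The `MOD_a` axioms are true under a valuation perturbed at `(P, Q)` whenever `P` is the
embedding of a `MOD`-free formula: the conjunctions occurring in a `MOD_a` axiom have a `MOD`
gate, or the negation of one, in their left component, so none of them is the perturbed pair, and
on them the valuation counts honestly. [cite: BussImpagliazzoKrajicekPudlakRazborovSgall1997, Def. 1.1] -/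
theorem conjPerturbedModVal_of_isModAxiom {P₀ : PropForm ℕ} {Q : PropFormMod a ℕ}
    {v : PropFormMod a ℕ → Bool}
    (hneg : ∀ φ, v (neg φ) = !v φ) (hdisj : ∀ φ ψ, v (disj φ ψ) = (v φ || v ψ))
    (hconj : ∀ φ ψ, v (conj φ ψ) = (decide (φ = ofPropForm P₀ ∧ ψ = Q) || (v φ && v ψ)))
    (hmod : ∀ (k : ℕ) (i : ZMod a) (args : Fin k → PropFormMod a ℕ),
      v (modc i args) = decide (((∑ j, (v (args j)).toNat : ℕ) : ZMod a) = i))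
    {θ : PropFormMod a ℕ} (hθ : IsModAxiom θ) : v θ = true := by
  -- no `MOD` gate, and no disjunction starting with a negated `MOD` gate, is `ofPropForm P₀`
  have hP1 : ∀ (R : PropForm ℕ) (k : ℕ) (i : ZMod a) (args : Fin k → PropFormMod a ℕ),
      (modc i args : PropFormMod a ℕ) ≠ ofPropForm R := by
    intro R k i args h
    cases R <;> simp [ofPropForm] at h
  have hP2 : ∀ (k : ℕ) (i : ZMod a) (args : Fin k → PropFormMod a ℕ) (B : PropFormMod a ℕ),
      (disj (neg (modc i args)) B : PropFormMod a ℕ) ≠ ofPropForm P₀ := by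
    intro k i args B h
    cases P₀ with
    | disj X Y =>
      simp only [ofPropForm, disj.injEq] at h
      obtain ⟨h1, -⟩ := h
      cases X with
      | neg Z =>
        simp only [ofPropForm, neg.injEq] at h1
        exact hP1 _ _ _ _ h1
      | _ => simp [ofPropForm] at h1
    | _ => simp [ofPropForm] at h
  rcases hθ with rfl | ⟨i, hi, rfl⟩ | ⟨i, k, ψ, φ, rfl⟩
  · rw [hmod]
    simp
  · rw [hneg, hmod]
    simpa using Ne.symm hi
  · simp only [biimp, hconj, hdisj, hneg, hmod, hP1, hP2, false_and, decide_false,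
      Bool.false_or, Fin.sum_univ_castSucc, Fin.snoc_castSucc, Fin.snoc_last, Nat.cast_add]
    cases v φ <;> simp [eq_sub_iff_add_eq]

/-- One inference step of `textbookFrege` in the extended language preserves truth under a
valuation perturbed at `(P, Q)`, unless its conclusion is the excluded line
`¬(P ∧ Q) ∨ ¬(¬P ∨ ¬Q)`. [folklore] -/
theorem conjPerturbedModVal_of_isModInferred {P Q : PropFormMod a ℕ} {v : PropFormMod a ℕ → Bool}
    (hconst : ∀ b, v (const b) = b) (hneg : ∀ φ, v (neg φ) = !v φ)
    (hdisj : ∀ φ ψ, v (disj φ ψ) = (v φ || v ψ))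
    (hconj : ∀ φ ψ, v (conj φ ψ) = (decide (φ = P ∧ ψ = Q) || (v φ && v ψ)))
    {prev : List (PropFormMod a ℕ)} {θ : PropFormMod a ℕ} (hprev : ∀ p ∈ prev, v p = true)
    (hinf : textbookFrege.IsModInferred prev θ)
    (hθ : θ ≠ disj (neg (conj P Q)) (neg (disj (neg P) (neg Q)))) : v θ = true := by
  obtain ⟨r, hr, σ, hconc, hprem⟩ := hinf
  simp only [textbookFrege, List.mem_cons, List.not_mem_nil, or_false] at hr
  rcases hr with rfl | rfl | rfl | rfl | rfl | rfl | rfl | rfl | rfl <;>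
    simp only [ofPropForm, PropFormMod.subst, List.mem_cons, List.not_mem_nil, or_false,
      forall_eq_or_imp, forall_eq] at hconc hprem <;> subst hconc
  · -- (1) `⊢ ¬A ∨ A`
    simp only [hdisj, hneg]
    cases v (σ 0) <;> rfl
  · -- (2) expansion `A ⊢ B ∨ A`
    have h0 := hprev _ hprem
    simp only [hdisj, h0, Bool.or_true]
  · -- (3) contraction `A ∨ A ⊢ A`
    have h0 := hprev _ hprem
    simpa [hdisj] using h0
  · -- (4) associativity `A ∨ (B ∨ C) ⊢ (A ∨ B) ∨ C`
    have h0 := hprev _ hprem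
    simp only [hdisj, Bool.or_assoc] at h0 ⊢
    exact h0
  · -- (5) cut `A ∨ B, ¬A ∨ C ⊢ B ∨ C`
    have h0 := hprev _ hprem.1
    have h1 := hprev _ hprem.2
    simp only [hdisj, hneg] at h0 h1 ⊢
    revert h0 h1
    cases v (σ 0) <;> cases v (σ 1) <;> cases v (σ 2) <;> simp
  · -- (6) `⊢ ¬(A ∧ B) ∨ ¬(¬A ∨ ¬B)`: the perturbed pair is excluded by `hθ`
    by_cases hc : σ 0 = P ∧ σ 1 = Q
    · obtain ⟨h0, h1⟩ := hc
      subst h0; subst h1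
      exact absurd rfl hθ
    · simp only [hdisj, hneg, hconj, decide_eq_false hc, Bool.false_or]
      cases v (σ 0) <;> cases v (σ 1) <;> rfl
  · -- (7) `⊢ ¬¬(¬A ∨ ¬B) ∨ (A ∧ B)`
    simp only [hdisj, hneg, hconj]
    cases v (σ 0) <;> cases v (σ 1) <;> simp
  · -- (8) `⊢ ⊤`
    exact hconst true
  · -- (9) `⊢ ¬⊥`
    rw [hneg, hconst]
    rfl

/-- All lines of a `textbookFrege(MOD_a)` derivation from no hypotheses which avoids the line
`¬(P ∧ Q) ∨ ¬(¬P ∨ ¬Q)`, `P = ofPropForm P₀`, are true under a valuation perturbed at `(P, Q)`.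
[folklore] -/
theorem conjPerturbedModVal_of_isModDerivation {P₀ : PropForm ℕ} {Q : PropFormMod a ℕ}
    {v : PropFormMod a ℕ → Bool}
    (hconst : ∀ b, v (const b) = b) (hneg : ∀ φ, v (neg φ) = !v φ)
    (hdisj : ∀ φ ψ, v (disj φ ψ) = (v φ || v ψ))
    (hconj : ∀ φ ψ, v (conj φ ψ) = (decide (φ = ofPropForm P₀ ∧ ψ = Q) || (v φ && v ψ)))
    (hmod : ∀ (k : ℕ) (i : ZMod a) (args : Fin k → PropFormMod a ℕ),
      v (modc i args) = decide (((∑ j, (v (args j)).toNat : ℕ) : ZMod a) = i))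
    {π : List (PropFormMod a ℕ)} (hπ : textbookFrege.IsModDerivation ∅ π)
    (hPQ : disj (neg (conj (ofPropForm P₀) Q))
      (neg (disj (neg (ofPropForm P₀)) (neg Q))) ∉ π) :
    ∀ ψ ∈ π, v ψ = true := by
  suffices H : ∀ (k : ℕ) (hk : k < π.length), v π[k] = true by
    intro ψ hψ
    obtain ⟨k, hk, rfl⟩ := List.getElem_of_mem hψ
    exact H k hk
  intro k
  induction k using Nat.strong_induction_on with
  | _ k ih =>
    intro hk
    rcases hπ k hk with hm | hax | hinf
    · exact absurd hm (Set.notMem_empty _)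
    · exact conjPerturbedModVal_of_isModAxiom hneg hdisj hconj hmod hax
    · refine conjPerturbedModVal_of_isModInferred hconst hneg hdisj hconj (fun p hp => ?_) hinf
        fun h => hPQ (h ▸ List.getElem_mem hk)
      obtain ⟨j, hj, hj'⟩ := List.getElem_of_mem hp
      rw [List.length_take] at hj
      rw [← hj', List.getElem_take]
      exact ih j (by omega) (by omega)

/-- **Every `textbookFrege(MOD_a)` proof of `¬(P ∧ Q)` with `P` `MOD`-free contains the line
`¬(P ∧ Q) ∨ ¬(¬P ∨ ¬Q)`** (under the perturbed valuation every other line is true and `¬(P ∧ Q)`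
is false). [folklore] -/
theorem conjAx_mem_of_isModProofOf {π : List (PropFormMod a ℕ)} {P₀ : PropForm ℕ}
    {Q : PropFormMod a ℕ}
    (h : textbookFrege.IsModProofOf π (neg (conj (ofPropForm P₀) Q))) :
    disj (neg (conj (ofPropForm P₀) Q)) (neg (disj (neg (ofPropForm P₀)) (neg Q))) ∈ π := by
  by_contra hPQ
  obtain ⟨v, hconst, hneg, hdisj, hconj, hmod⟩ := exists_conjPerturbedModVal (ofPropForm P₀ : PropFormMod a ℕ) Q
  have hlast : neg (conj (ofPropForm P₀) Q) ∈ π := List.mem_of_getLast? h.2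
  have := conjPerturbedModVal_of_isModDerivation hconst hneg hdisj hconj hmod h.1 hPQ _ hlast
  rw [hneg, hconj] at this
  simp at this

/-! ### Part 2. Alternation depth of the forced line -/

/-- The forced line is at least `4` deeper than `Q` read under a `¬`:
`altDepth (¬(P∧Q) ∨ ¬(¬P ∨ ¬Q)) ≥ altDepthAux 1 Q + 4` (extended language). [folklore] -/
theorem altDepthAux_add_four_le_altDepth_modConjAx (P Q : PropFormMod a ℕ) :
    altDepthAux 1 Q + 4 ≤ altDepth (disj (neg (conj P Q)) (neg (disj (neg P) (neg Q)))) := by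
  simp [altDepth, altDepthAux]

/-- A depth-`d` `textbookFrege(MOD_a)` proof of `¬(P ∧ Q)`, `P` `MOD`-free, needs
`d ≥ altDepthAux 1 Q + 4`. [folklore] -/
theorem altDepthAux_add_four_le_of_isModDepthProofOf {d : ℕ} {π : List (PropFormMod a ℕ)}
    {P₀ : PropForm ℕ} {Q : PropFormMod a ℕ}
    (h : textbookFrege.IsModDepthProofOf d π (neg (conj (ofPropForm P₀) Q))) :
    altDepthAux 1 Q + 4 ≤ d :=
  (altDepthAux_add_four_le_altDepth_modConjAx _ Q).trans (h.2 _ (conjAx_mem_of_isModProofOf h.1))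

/-- **Depth floor for refuting a CNF in `textbookFrege(MOD_a)`.** If the tail `φ` of a clause
list `C :: φ` contains a negative literal, every depth-`d` `textbookFrege(MOD_a)` proof of (the
embedding of) `¬ ofCNF (C :: φ)` has `d ≥ 7`. [folklore] -/
theorem seven_le_of_isModDepthProofOf_neg_ofCNF {d : ℕ} {π : List (PropFormMod a ℕ)}
    {C : Clause ℕ} {φ : CNF ℕ} (hφ : ∃ D ∈ φ, ∃ l ∈ D, l.2 = false)
    (h : textbookFrege.IsModDepthProofOf d π
      (ofPropForm (PropForm.neg (PropForm.ofCNF (C :: φ))))) : 7 ≤ d := by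
  rw [ofCNF_cons] at h
  simp only [ofPropForm] at h
  have h1 := altDepthAux_add_four_le_of_isModDepthProofOf h
  have h2 := three_le_altDepthAux_one_ofCNF hφ
  rw [altDepthAux_ofPropForm] at h1
  omega

end ConjAxiom

/-! ### Part 3. The `d ≤ 6` and `ℓ ≤ 8` slices of the item -/

/-- **No `textbookFrege(MOD_a)` proof of alternation depth `≤ 6` refutes the XOR-CNF of an
`ℓ`-sparse, `(r, 3/4·ℓ)`-boundary-expanding (`r ≥ 2`), unsolvable system over `𝔽₂`** (any
modulus `a`). [folklore] -/
theorem not_isModDepthProofOf_of_le_six {a ℓ n m d : ℕ} {r : ℝ} (E : Fin m → LinEqMod 2 n)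
    (hℓ : 1 ≤ ℓ) (hr : 2 ≤ r) (hd : d ≤ 6) (hsparse : ∀ i, (E i).supp.card ≤ ℓ)
    (hexp : IsBoundaryExpander (fun i => (E i).supp.map Fin.valEmbedding) r (3 / 4 * ℓ))
    (hunsat : ¬ SystemSat E Finset.univ) (π : List (PropFormMod a ℕ)) :
    ¬ textbookFrege.IsModDepthProofOf d π
      (ofPropForm (PropForm.neg (PropForm.ofCNF (sumEncoding 1 E)))) := by
  intro h
  obtain ⟨C, φ, hL, hφ⟩ := exists_neg_clause_tail E hℓ hr hsparse hexp hunsat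
  rw [hL] at h
  have := seven_le_of_isModDepthProofOf_neg_ofCNF hφ h
  omega

/-- **The `d ≤ 6` slice of `LinearGeneratorModPFregeHard` holds** (vacuously, for every modulus:
with `N = ⌈2^{1/(1-δ)}⌉` there is no depth-`≤ 6` `textbookFrege(MOD_p)` proof of
`¬ ofCNF (sumEncoding 1 E)` for any `ℓ`-sparse `(n^{1-δ}, 3/4·ℓ)`-boundary-expanding unsolvable
`E`, `n ≥ N`). The statement is the route decl
`Summit.PneNP.PneNP.Theses.ExpanderLinearGenerators.LinearGeneratorModPFregeHard` with the extra
hypothesis `d ≤ 6` (sharpening `linearGeneratorModPFregeHard_of_depth_le_four`). [folklore] -/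
theorem linearGeneratorModPFregeHard_depth_le_six :
    ∀ (p : ℕ), p.Prime → p ≠ 2 → ∀ (ℓ d : ℕ) (δ : ℝ), 1 ≤ ℓ → 0 < δ → δ < 1 → d ≤ 6 →
      ∃ ε : ℝ, 0 < ε ∧ ∃ N : ℕ, ∀ n : ℕ, N ≤ n →
      ∀ (m : ℕ) (E : Fin m → Literature.Computability.MetaComplexity.LinEqMod 2 n),
        (∀ i, (E i).supp.card ≤ ℓ) →
        Literature.Computability.MetaComplexity.IsBoundaryExpander
          (fun i => (E i).supp.map Fin.valEmbedding) ((n : ℝ) ^ (1 - δ)) (3 / 4 * ℓ) →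
        ¬ Literature.Computability.MetaComplexity.SystemSat E Finset.univ →
        ∀ π : List (Literature.Computability.MetaComplexity.PropFormMod p ℕ),
          Literature.Computability.MetaComplexity.textbookFrege.IsModDepthProofOf d π
            (Literature.Computability.MetaComplexity.PropFormMod.ofPropForm
              (Literature.Computability.Complexity.PropForm.neg
                (Literature.Computability.Complexity.PropForm.ofCNF
                  (Literature.Computability.MetaComplexity.sumEncoding 1 E)))) →
          (2 : ℝ) ^ ((n : ℝ) ^ ε) ≤ (Literature.Computability.MetaComplexity.modProofSize π : ℝ) := by
  intro p _hp _hp2 ℓ d δ hℓ _hδ hδ1 hd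
  refine ⟨1, one_pos, ⌈(2 : ℝ) ^ (1 / (1 - δ))⌉₊, fun n hn m E hsparse hexp hunsat π hπ => ?_⟩
  exact absurd hπ (not_isModDepthProofOf_of_le_six E hℓ (two_le_rpow_of_ceil_le hδ1 hn) hd
    hsparse hexp hunsat π)

/-- **The `ℓ ≤ 8` slice of `LinearGeneratorModPFregeHard` holds** (vacuously: with the threshold
`N` of `exists_nat_log_threshold` for the exponent `1 - δ`, every `ℓ`-sparse
`(n^{1-δ}, 3/4·ℓ)`-boundary-expanding system over `𝔽₂` in `n ≥ N` variables with `ℓ ≤ 8` is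
solvable, by `systemSat_of_isBoundaryExpander_of_le_eight`). The statement is the route decl with
the extra hypothesis `ℓ ≤ 8`. [folklore] -/
theorem linearGeneratorModPFregeHard_locality_le_eight :
    ∀ (p : ℕ), p.Prime → p ≠ 2 → ∀ (ℓ d : ℕ) (δ : ℝ), 1 ≤ ℓ → 0 < δ → δ < 1 → ℓ ≤ 8 →
      ∃ ε : ℝ, 0 < ε ∧ ∃ N : ℕ, ∀ n : ℕ, N ≤ n →
      ∀ (m : ℕ) (E : Fin m → Literature.Computability.MetaComplexity.LinEqMod 2 n),
        (∀ i, (E i).supp.card ≤ ℓ) →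
        Literature.Computability.MetaComplexity.IsBoundaryExpander
          (fun i => (E i).supp.map Fin.valEmbedding) ((n : ℝ) ^ (1 - δ)) (3 / 4 * ℓ) →
        ¬ Literature.Computability.MetaComplexity.SystemSat E Finset.univ →
        ∀ π : List (Literature.Computability.MetaComplexity.PropFormMod p ℕ),
          Literature.Computability.MetaComplexity.textbookFrege.IsModDepthProofOf d π
            (Literature.Computability.MetaComplexity.PropFormMod.ofPropForm
              (Literature.Computability.Complexity.PropForm.neg
                (Literature.Computability.Complexity.PropForm.ofCNF
                  (Literature.Computability.MetaComplexity.sumEncoding 1 E)))) →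
          (2 : ℝ) ^ ((n : ℝ) ^ ε) ≤ (Literature.Computability.MetaComplexity.modProofSize π : ℝ) := by
  intro p _hp _hp2 ℓ d δ hℓ _hδ hδ1 hℓ8
  obtain ⟨N, hN⟩ := exists_nat_log_threshold (by linarith : 0 < 1 - δ)
  refine ⟨1, one_pos, N, fun n hn m E hsparse hexp hunsat π _hπ => ?_⟩
  exact absurd (systemSat_of_isBoundaryExpander_of_le_eight E hℓ hℓ8 hsparse
    (Nat.lt_pow_succ_log_self one_lt_two n) (hN n hn) hexp) hunsat

open Summit.PneNP.PneNP.Theses.ExpanderLinearGenerators in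
/-- **Reduction of the `AC⁰[p]` rung to locality `≥ 9` and depth `≥ 7`.** Item stmt-PneNP-11444
(`LinearGeneratorModPFregeHard`) is equivalent to its restriction to `ℓ ≥ 9` and `d ≥ 7`: the
corners `ℓ ≤ 8` (`linearGeneratorModPFregeHard_locality_le_eight`) and `d ≤ 6`
(`linearGeneratorModPFregeHard_depth_le_six`) hold vacuously. All of the item's content — a
superpolynomial `F_d(MOD_p)` lower bound, `p` odd, for the XOR-CNFs of expanding unsolvable linear
systems over `𝔽₂` (an instance of Krajíček's Problem 15.6.1) — lives in `ℓ ≥ 9`, `d ≥ 7`.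
[cite: KrajicekProofComplexity2019, Problem 15.6.1] -/
theorem linearGeneratorModPFregeHard_iff_nine_le_and_seven_le :
    LinearGeneratorModPFregeHard ↔
    ∀ (p : ℕ), p.Prime → p ≠ 2 → ∀ (ℓ d : ℕ) (δ : ℝ), 1 ≤ ℓ → 0 < δ → δ < 1 → 9 ≤ ℓ → 7 ≤ d →
      ∃ ε : ℝ, 0 < ε ∧ ∃ N : ℕ, ∀ n : ℕ, N ≤ n →
      ∀ (m : ℕ) (E : Fin m → Literature.Computability.MetaComplexity.LinEqMod 2 n),
        (∀ i, (E i).supp.card ≤ ℓ) →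
        Literature.Computability.MetaComplexity.IsBoundaryExpander
          (fun i => (E i).supp.map Fin.valEmbedding) ((n : ℝ) ^ (1 - δ)) (3 / 4 * ℓ) →
        ¬ Literature.Computability.MetaComplexity.SystemSat E Finset.univ →
        ∀ π : List (Literature.Computability.MetaComplexity.PropFormMod p ℕ),
          Literature.Computability.MetaComplexity.textbookFrege.IsModDepthProofOf d π
            (Literature.Computability.MetaComplexity.PropFormMod.ofPropForm
              (Literature.Computability.Complexity.PropForm.neg
                (Literature.Computability.Complexity.PropForm.ofCNF
                  (Literature.Computability.MetaComplexity.sumEncoding 1 E)))) →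
          (2 : ℝ) ^ ((n : ℝ) ^ ε) ≤ (Literature.Computability.MetaComplexity.modProofSize π : ℝ) := by
  refine ⟨fun h p hp hp2 ℓ d δ hℓ hδ hδ1 _ _ => h p hp hp2 ℓ d δ hℓ hδ hδ1,
    fun h p hp hp2 ℓ d δ hℓ hδ hδ1 => ?_⟩
  by_cases hℓ9 : 9 ≤ ℓ
  · by_cases hd : 7 ≤ d
    · exact h p hp hp2 ℓ d δ hℓ hδ hδ1 hℓ9 hd
    · exact linearGeneratorModPFregeHard_depth_le_six p hp hp2 ℓ d δ hℓ hδ hδ1 (by omega)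
  · exact linearGeneratorModPFregeHard_locality_le_eight p hp hp2 ℓ d δ hℓ hδ hδ1 (by omega)

end Summit.PneNP.PneNP.Theorems
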